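import Summits.QuantumFields.BalabanUV.T4Continuum.Support.B13Carriers
import Literature.MathematicalPhysics.QuantumFieldTheory.Balaban1983to89.T4BoundaryCarrier

/-!
# BoundaryCarriersB13 — the BOUNDARY MEMBER's carriers on the T⁴ setting: the row's concrete `T4OutputRate.Carriers`
(`B13Carriers.TwoRuns.carriers`, row O1-a of `t4/b2b-balaban-t4-ne5-p1/O1-CLAIM-TABLE-NE5-P1.md`, instance of record p207668) EXTENDED to
`T4BoundaryCarrier.Carriers` by the pending fluctuation fields — annex row OB-a of the ROUND-2 skeleton `t4/skeletons/NE5-t4-ne5-p3.md`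
(v1.2 §7; O1-B design `t4/b2b-balaban-t4-ne5-p3/g17/B14BoundaryStepDesign.md` v0.2 §2, QB4, QB6) (cell `pub-balaban`, T⁴ fan-out,
`HOME/BINDER-OWNERS.md` row NE5, route P3 «boundary-functional member»; lineage t4-ne5-p3 gen 17; typing + bookkeeping only; imports the
swarm's `Support.B13Carriers` (p207668, writer-of-record leaf-05) and the Literature carrier `T4BoundaryCarrier` ONLY, modifies neither)

HONEST FRAMING (T4-DAG PAGE 1).  The cell's T⁴ target is rung (B)+1: existence AND uniqueness of the ε → 0 limit of Bałaban's
unit-scale averaged loop expectations on a FIXED finite torus — NOT infinite volume, NOT a mass gap, NOT the Clay problem.  HONEST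
DEPENDENCY (cell line, verbatim): «continuum YM on T⁴ ⇐ BetaPertH ∧ nine spine estimates (0/9 proved); BetaPertH ⇐ (D1) ∧ (D4) ∧
CAP+tail; G-an2-4 gates asym, D1 and NE2/3/4.»  Nothing of Bałaban's objects is asserted; `T4BoundaryCarrier.NE5B` is NOT PRINTED and
NOT proved here.

WHAT THIS MODULE DOES.  `T4BoundaryCarrier.Carriers extends T4OutputRate.Carriers` by exactly two fields, `Fl` (pending fluctuation
configurations restricted to a domain — [Balaban1988Convergent] p. 258 *"Let us denote the system of the fluctuation fields {A_{j−1}}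
by A"*) and `admFl` (the admissible ones — the real points of the polydisc of (3.43) p. 276 *"{A : supp A ⊂ Y∩Λ^{(k)*}_{k+1}, |A| <
C₁p₁(g_k)}"*).  §1 `PendingFields` (the datum) and `boundaryCarriers R P` := the row's `R.carriers` with those two fields — so the
E-member (`T4OutputRate.Functional` over `R.carriers`) and the boundary member (`T4BoundaryCarrier.BFunctional` over
`boundaryCarriers R P`) share ONE index type, ONE pair of background carriers and ONE transport (`boundaryCarriers_toCarriers`, rfl);
§2 the typed polydisc datum `polydiscPending` (coordinates `ι → ℝ`, radii `r : ι → ℝ`; nonempty for positive radii) and the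
degenerate datum `noPending` (for the R-step's 𝐁′, functions of the background only: [Balaban1989LargeFieldII] p. 390); §3 the
regular channel of the boundary frame takes the E- and R-members TOGETHER (design QB4): `T4OutputRate.NE5`, `DecayBound` are additive
in the functional (`ne5_add`, `decayBound_add`), so ONE `hE` binder of `T4BoundaryRate.ne5B_of_generation` serves `EB := E + R″`.
CARRIER-EXTENSION CONVENTION (design QB6, cell GAPS G-ne5p3-12; recorded, nothing asserted): with `R.admB` larger than the final-step
space (the boundary member's chart and encoding need the displaced ∕ complex configurations), run B's tables are extended off run B's
index-dependent space BY RUN A's TRANSPORTED VALUES (two-run binders trivial off-space, genuine on-space), run A's by 0 off its own.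
Names used — `B13Carriers`: `TwoRuns`, `TwoRuns.carriers` (+ `_scale`, `_d`); `T4BoundaryCarrier`: `Carriers`, `BFunctional`, `atFl`;
`T4OutputRate`: `Functional`, `NE5`, `DecayBound`.
-/

namespace Summit.QuantumFields.BalabanUV.T4Continuum.BoundaryCarriersB13

open Literature.MathematicalPhysics.QuantumFieldTheory.Balaban1983to89
open Literature.MathematicalPhysics.QuantumFieldTheory.Balaban1983to89.T4OutputRate (Carriers Functional NE5 DecayBound)
open B13Carriers

noncomputable section

/-! ## §1 The pending-field datum and the extended carriers -/

/-- **DATUM `PendingFields`** [bookkeeping]: a carrier `Fl` of pending fluctuation configurations restricted to a domain and its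
admissible subset `admFl` (printed TYPE: the polydisc of [Balaban1988Convergent] (3.43) p. 276; the instancer chooses).
[cite: Balaban1988Convergent, (3.43) p.276] -/
structure PendingFields where
  /-- pending fluctuation configurations -/
  Fl : Type
  /-- admissible pending configurations -/
  admFl : Set Fl

variable {G : Type} [GaugeGroup G]

/-- **THE BOUNDARY CARRIERS OF THE T⁴ SETTING** [bookkeeping]: the row's concrete carriers `R.carriers` (domains `Σ_j 𝐃_j` on the torus,
`scale`, torus tree length, the two runs' admissible backgrounds, bondwise gauge, one block averaging) with the pending-field datum
adjoined — annex row OB-a.  No estimate inside. -/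
def boundaryCarriers (R : TwoRuns G) (P : PendingFields) : T4BoundaryCarrier.Carriers :=
  { R.carriers with Fl := P.Fl, admFl := P.admFl }

/-- The underlying output carriers ARE the row's carriers — one index type, one background pair, one transport for both members.
[folklore] -/
@[simp] theorem boundaryCarriers_toCarriers (R : TwoRuns G) (P : PendingFields) :
    (boundaryCarriers R P).toCarriers = R.carriers := rfl

/-- The pending-field carrier, unfolded. [folklore] -/
@[simp] theorem boundaryCarriers_Fl (R : TwoRuns G) (P : PendingFields) : (boundaryCarriers R P).Fl = P.Fl := rfl

/-- The admissible pending fields, unfolded. [folklore] -/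
@[simp] theorem boundaryCarriers_admFl (R : TwoRuns G) (P : PendingFields) : (boundaryCarriers R P).admFl = P.admFl := rfl

/-- `scale` on the boundary carriers is the creation step of the row's carriers. [folklore] -/
@[simp] theorem boundaryCarriers_scale (R : TwoRuns G) (P : PendingFields) (X : (boundaryCarriers R P).Dom) :
    (boundaryCarriers R P).scale X = X.1 := rfl

/-- A boundary functional frozen at a pending field is an output functional ON THE ROW'S CARRIERS (so every `T4OutputRate` ∕ E-member
shape applies to it verbatim). [folklore] -/
theorem atFl_isFunctional (R : TwoRuns G) (P : PendingFields) {Bg : Type}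
    (B : T4BoundaryCarrier.BFunctional (boundaryCarriers R P) Bg) (a : P.Fl) :
    (T4BoundaryCarrier.atFl B a : Functional R.carriers Bg) = fun g U X => B g U a X := rfl

/-! ## §2 Two pending-field data: the printed polydisc, and none -/

/-- **THE POLYDISC DATUM** [bookkeeping]: pending configurations in coordinates `ι → ℝ` (`ι` = the pending steps' bond∕component labels on
the domain), admissible = the open polydisc of radii `r` — the real points of (3.43)'s *"|A| < C₁p₁(g_k)"* with `r` the instancer's
reading of `C₁p₁(g_k)` per pending step.  CONTEXT only. [cite: Balaban1988Convergent, (3.43) p.276] -/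
def polydiscPending (ι : Type) (r : ι → ℝ) : PendingFields where
  Fl := ι → ℝ
  admFl := {A | ∀ i, |A i| < r i}

/-- Membership in the polydisc, unfolded. [folklore] -/
theorem mem_polydiscPending {ι : Type} {r : ι → ℝ} {A : ι → ℝ} :
    A ∈ (polydiscPending ι r).admFl ↔ ∀ i, |A i| < r i := Iff.rfl

/-- The zero configuration is admissible for positive radii — the datum is not vacuous. [folklore] -/
theorem zero_mem_polydiscPending {ι : Type} {r : ι → ℝ} (hr : ∀ i, 0 < r i) :
    (fun _ => (0 : ℝ)) ∈ (polydiscPending ι r).admFl := fun i => by simpa using hr i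

/-- **NO PENDING FIELD** [bookkeeping]: the degenerate datum for boundary terms that are functions of the background only — the R-step's
new boundary terms 𝐁′^{(k)}(X) of [Balaban1989LargeFieldII] (1.98)–(1.101) p. 390 (*"depends on the background field U_k restricted to
X"*).  CONTEXT only. [cite: Balaban1989LargeFieldII, (1.99) p.390] -/
def noPending : PendingFields where
  Fl := Unit
  admFl := Set.univ

/-- On the no-pending datum every shape «uniform in the admissible pending field» is its `T4OutputRate` counterpart at the unique
point: e.g. `NE5B` is ONE `NE5`. [folklore] -/
theorem ne5B_noPending_iff (R : TwoRuns G) (BA : T4BoundaryCarrier.BFunctional (boundaryCarriers R noPending) R.carriers.BgA)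
    (BB : T4BoundaryCarrier.BFunctional (boundaryCarriers R noPending) R.carriers.BgB) (W : Set (ℕ → ℝ)) (κ θ C₅ : ℝ) :
    T4BoundaryCarrier.NE5B BA BB W κ θ C₅ ↔
      NE5 (C := R.carriers) (T4BoundaryCarrier.atFl BA ()) (T4BoundaryCarrier.atFl BB ()) W κ θ C₅ := by
  constructor
  · intro h
    exact h () trivial
  · intro h a _
    cases a
    exact h

/-! ## §3 The regular channel takes the E- and R-members together: additivity of the row's shapes -/

section Additive

variable {C : Carriers}

/-- `DecayBound` is additive in the functional (levels add). [folklore] -/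
theorem decayBound_add {Bg : Type} {E₁ E₂ : Functional C Bg} {W : Set (ℕ → ℝ)} {B₁ B₂ κ : ℝ}
    (h₁ : DecayBound E₁ W B₁ κ) (h₂ : DecayBound E₂ W B₂ κ) : DecayBound (E₁ + E₂) W (B₁ + B₂) κ := by
  intro g hg U X
  have e : (E₁ + E₂) g U X = E₁ g U X + E₂ g U X := rfl
  rw [e, add_mul]
  exact (abs_add_le _ _).trans (add_le_add (h₁ g hg U X) (h₂ g hg U X))

/-- **`NE5` IS ADDITIVE IN THE FUNCTIONAL** [folklore]: the E-member's and the R-member's rates give the rate of their sum (constants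
add) — so the boundary frame's single regular-channel binder `hE : NE5 EA EB W κ θ CE` (`T4BoundaryRate.ne5B_of_generation`) is served by
`EB := E + R″` with `CE := C_E + C_R` (design QB4). -/
theorem ne5_add {E₁A E₂A : Functional C C.BgA} {E₁B E₂B : Functional C C.BgB} {W : Set (ℕ → ℝ)} {κ θ C₁ C₂ : ℝ}
    (h₁ : NE5 E₁A E₁B W κ θ C₁) (h₂ : NE5 E₂A E₂B W κ θ C₂) : NE5 (E₁A + E₂A) (E₁B + E₂B) W κ θ (C₁ + C₂) := by
  intro g hg U X
  have eA : (E₁A + E₂A) g (C.transport U) X = E₁A g (C.transport U) X + E₂A g (C.transport U) X := rfl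
  have eB : (E₁B + E₂B) g U X = E₁B g U X + E₂B g U X := rfl
  rw [eA, eB]
  have hsplit : E₁A g (C.transport U) X + E₂A g (C.transport U) X - (E₁B g U X + E₂B g U X)
      = (E₁A g (C.transport U) X - E₁B g U X) + (E₂A g (C.transport U) X - E₂B g U X) := by ring
  rw [hsplit]
  calc |E₁A g (C.transport U) X - E₁B g U X + (E₂A g (C.transport U) X - E₂B g U X)|
      ≤ |E₁A g (C.transport U) X - E₁B g U X| + |E₂A g (C.transport U) X - E₂B g U X| := abs_add_le _ _
    _ ≤ C₁ * θ ^ C.scale X * Real.exp (-(κ * C.d X)) + C₂ * θ ^ C.scale X * Real.exp (-(κ * C.d X)) :=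
        add_le_add (h₁ g hg U X) (h₂ g hg U X)
    _ = (C₁ + C₂) * θ ^ C.scale X * Real.exp (-(κ * C.d X)) := by ring

end Additive

end

end Summit.QuantumFields.BalabanUV.T4Continuum.BoundaryCarriersB13
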